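import Mathlib
import Summits.Ventures.HodgeRepro.Tier4.Line1.RTFSetting
import Summits.Ventures.HodgeRepro.Tier4.Line1.KernelSupportFinite
import Summits.Ventures.HodgeRepro.Tier4.Line1.KernelUnfold
import Summits.Ventures.HodgeRepro.Tier4.Line1.KernelOperator

/-!
# Tier4/Line1/KernelEigen — LINE L1, J1 rung (3): eigenvectors of the kernel operator are continuous invariant functions

Blind re-derivation cell `pub-hodge-repro`, Tier 4 «prove the step» (README §9–§10), seat t4-L1-p1 (prover, gen 0),
self-pointed (S12388) on LINE L1 (the RTF line) as the next rung of J1 `exists_adaptedONB` after rungs (0)–(2): an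
`L²(DG)`-eigenvector of the kernel operator `K_f` with a non-zero eigenvalue has a representative which is a continuous
left-`G(k)`-invariant function on `G` — so the eigenspaces of the compact operators `R(f̄ ⋆ f)` (rung (2)) consist of
continuous invariant functions, the material of an `IsAdaptedONB`.  Generic over every `RTF.Setting`; the only
hypothesis beyond the setting is `[SecondCountableTopology G]` (for the countably generated `𝓝 x₀` in dominated
convergence; the adelic instance has it).  No `sorry`; axioms = the trio.

THE MATHEMATICS.  (i) `x ↦ (K_f ψ)(x) = ∫_{DG} K_f(x, z) ψ(z) dμ(z)` is continuous for integrable `ψ`: near `x₀`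
and uniformly for `z ∈ closure DG` the kernel is the finite sum `∑_{γ ∈ F} f(x⁻¹ γ z)` over the finitely many rational
`γ` with `x₀⁻¹ γ (closure DG)` meeting `tsupport f` (the tube lemma on the compact `closure DG × tsupport f`: a
rational value `x₀ s z⁻¹` is isolated by discreteness, a non-rational one is kept off `G(k)` by closedness — the
argument of `kernel_continuous`), so `‖K_f(x, z) ψ(z)‖ ≤ #F · sup‖f‖ · ‖ψ(z)‖` there and dominated convergence
applies.  (ii) `K_f(γ x, z) = K_f(x, z)` for `γ ∈ G(k)` (`kernel_mul_left`), so `K_f ψ` is left-invariant.  (iii) If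
`K_f ψ = c ψ` a.e. with `c ≠ 0`, then `ψ' := c⁻¹ K_f ψ` is continuous, invariant, and `= ψ` a.e.

Nothing here says anything about the status of the Hodge conjecture for CM abelian varieties, which is NOT proved
(HC_CM is NOT proved by anyone in this repository).
-/

set_option autoImplicit false

noncomputable section

namespace Summit.Ventures.HodgeRepro.Tier4.Line1

open MeasureTheory Topology

namespace RTF

variable {G : Type} [Group G] [TopologicalSpace G] [IsTopologicalGroup G] [MeasurableSpace G]
  [BorelSpace G]

omit [Group G] [IsTopologicalGroup G] [MeasurableSpace G] [BorelSpace G] in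
/-- helper (proved): a test function is bounded on all of `G` (bounded on its compact closed support, zero outside). -/
theorem exists_bound_of_isTest {f : G → ℂ} (hf : IsTest f) : ∃ C : ℝ, 0 ≤ C ∧ ∀ x, ‖f x‖ ≤ C := by
  obtain ⟨C, hC⟩ := hf.compact.isCompact.exists_bound_of_continuousOn hf.cont.continuousOn
  refine ⟨max C 0, le_max_right _ _, fun x => ?_⟩
  by_cases hx : x ∈ tsupport f
  · exact (hC x hx).trans (le_max_left _ _)
  · rw [image_eq_zero_of_notMem_tsupport hx, norm_zero]
    exact le_max_right _ _

namespace Setting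

variable (S : Setting G)

omit [BorelSpace G] in
/-- helper (proved): near `x₀`, uniformly for `z ∈ closure DG`, the kernel is a finite sum over a fixed finite set of
rational points (the tube lemma on the compact `closure DG × tsupport f`; `G(k)` discrete and closed). -/
theorem eventually_kernel_eq_sum {f : G → ℂ} (hf : IsTest f) (x₀ : G) :
    ∃ F : Finset S.Gk, ∀ᶠ x in 𝓝 x₀, ∀ z ∈ closure S.DG,
      S.kernel f x z = ∑ γ ∈ F, f (x⁻¹ * γ * z) := by
  haveI : DiscreteTopology S.Gk := S.discrete
  -- the finitely many rational points `γ` with `x₀⁻¹ γ (closure DG)` meeting the support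
  have hK : IsCompact ((fun p : G × G => x₀ * p.2 * p.1⁻¹) '' (closure S.DG ×ˢ tsupport f)) :=
    (S.compG.prod hf.compact.isCompact).image
      ((continuous_const.mul continuous_snd).mul continuous_fst.inv)
  have hFfin : {γ : S.Gk | ∃ z ∈ closure S.DG, x₀⁻¹ * γ * z ∈ tsupport f}.Finite := by
    refine S.finite_of_subset_compact hK ?_
    rintro γ ⟨z, hz, hs⟩
    exact ⟨(z, x₀⁻¹ * γ * z), ⟨hz, hs⟩, by show x₀ * (x₀⁻¹ * γ * z) * z⁻¹ = γ; group⟩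
  refine ⟨hFfin.toFinset, ?_⟩
  -- the continuous map `(x, (z, s)) ↦ x s z⁻¹`
  have hm : Continuous fun q : G × (G × G) => q.1 * q.2.2 * q.2.1⁻¹ :=
    (continuous_fst.mul (continuous_snd.comp continuous_snd)).mul
      (continuous_fst.comp continuous_snd).inv
  -- the tube lemma: near `x₀`, every rational point of the form `x s z⁻¹` (`z ∈ closure DG`, `s ∈ tsupport f`) is
  -- one of the finitely many
  have hev : ∀ᶠ x in 𝓝 x₀, ∀ p ∈ closure S.DG ×ˢ tsupport f, ∀ γ : S.Gk,
      (γ : G) = x * p.2 * p.1⁻¹ → γ ∈ {γ : S.Gk | ∃ z ∈ closure S.DG, x₀⁻¹ * γ * z ∈ tsupport f} := by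
    refine (S.compG.prod hf.compact.isCompact).eventually_forall_of_forall_eventually ?_
    rintro ⟨z, s⟩ ⟨hz, hs⟩
    by_cases hγ₁ : x₀ * s * z⁻¹ ∈ S.Gk
    · -- a rational point: discreteness isolates it
      obtain ⟨V, hVo, hV⟩ :=
        isOpen_induced_iff.mp (isOpen_discrete ({(⟨_, hγ₁⟩ : S.Gk)} : Set S.Gk))
      have hmem : x₀ * s * z⁻¹ ∈ V := by
        have : (⟨_, hγ₁⟩ : S.Gk) ∈ Subtype.val ⁻¹' V := by
          rw [hV]
          exact Set.mem_singleton _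
        exact this
      filter_upwards [hm.continuousAt.preimage_mem_nhds (hVo.mem_nhds hmem)] with q hq γ hγq
      have hγV : γ ∈ (Subtype.val ⁻¹' V : Set S.Gk) := by
        show (γ : G) ∈ V
        rw [hγq]
        exact hq
      rw [hV, Set.mem_singleton_iff] at hγV
      rw [hγV]
      refine ⟨z, hz, ?_⟩
      show x₀⁻¹ * (x₀ * s * z⁻¹) * z ∈ tsupport f
      have hs' : x₀⁻¹ * (x₀ * s * z⁻¹) * z = s := by group
      rw [hs']
      exact hs
    · -- not a rational point: closedness keeps a neighbourhood off `Gk`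
      have hopen : IsOpen ((S.Gk : Set G)ᶜ) := S.closed.isOpen_compl
      have hmem : x₀ * s * z⁻¹ ∈ (S.Gk : Set G)ᶜ := hγ₁
      filter_upwards [hm.continuousAt.preimage_mem_nhds (hopen.mem_nhds hmem)] with q hq γ hγq
      have h2 : (γ : G) ∈ S.Gk := γ.2
      rw [hγq] at h2
      exact absurd h2 hq
  filter_upwards [hev] with x hx z hz
  unfold kernel
  apply tsum_eq_sum
  intro γ hγ
  by_contra hne
  apply hγ
  rw [hFfin.mem_toFinset]
  exact hx (z, x⁻¹ * γ * z) ⟨hz, subset_tsupport f hne⟩ γ (by show (γ : G) = x * (x⁻¹ * γ * z) * z⁻¹; group)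

/-- helper (proved): the kernel operator of an integrable function is continuous on `G` (dominated convergence at each
`x₀`, with the bound `#F · sup‖f‖ · ‖ψ‖` of `eventually_kernel_eq_sum`). -/
theorem continuous_kernelOp [SecondCountableTopology G] {f : G → ℂ} (hf : IsTest f) {ψ : G → ℂ}
    (hψ : Integrable ψ (S.μ.restrict S.DG)) : Continuous (S.kernelOp f ψ) := by
  rw [continuous_iff_continuousAt]
  intro x₀
  obtain ⟨F, hF⟩ := S.eventually_kernel_eq_sum hf x₀
  obtain ⟨C, -, hC⟩ := exists_bound_of_isTest hf
  have hmeas : ∀ x : G,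
      AEStronglyMeasurable (fun z => S.kernel f x z * ψ z) (S.μ.restrict S.DG) := fun x =>
    ((S.kernel_continuous hf).comp (Continuous.prodMk_right x)).aestronglyMeasurable.mul
      hψ.aestronglyMeasurable
  have hbound : ∀ᶠ x in 𝓝 x₀, ∀ᵐ z ∂(S.μ.restrict S.DG),
      ‖S.kernel f x z * ψ z‖ ≤ (F.card * C) * ‖ψ z‖ := by
    filter_upwards [hF] with x hx
    filter_upwards [ae_restrict_mem₀ S.fdG.nullMeasurableSet] with z hz
    rw [norm_mul, hx z (subset_closure hz)]
    refine mul_le_mul_of_nonneg_right ?_ (norm_nonneg _)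
    calc ‖∑ γ ∈ F, f (x⁻¹ * γ * z)‖ ≤ ∑ γ ∈ F, ‖f (x⁻¹ * γ * z)‖ := norm_sum_le _ _
      _ ≤ ∑ _γ ∈ F, C := Finset.sum_le_sum fun γ _ => hC _
      _ = F.card * C := by simp [Finset.sum_const, nsmul_eq_mul]
  have hlim : ∀ᵐ z ∂(S.μ.restrict S.DG), Filter.Tendsto (fun x => S.kernel f x z * ψ z) (𝓝 x₀)
      (𝓝 (S.kernel f x₀ z * ψ z)) :=
    Filter.Eventually.of_forall fun z =>
      (((S.kernel_continuous hf).comp (Continuous.prodMk_left z)).tendsto x₀).mul tendsto_const_nhds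
  exact tendsto_integral_filter_of_dominated_convergence _ (Filter.Eventually.of_forall hmeas) hbound
    (hψ.norm.const_mul _) hlim

omit [IsTopologicalGroup G] [BorelSpace G] in
/-- helper (proved): the kernel operator is left-`G(k)`-invariant (`kernel_mul_left`). -/
theorem kernelOp_invariant (f ψ : G → ℂ) : S.Invariant (S.kernelOp f ψ) := by
  intro γ x
  unfold kernelOp
  simp only [S.kernel_mul_left f γ x]

/-- J1 rung (3) (M, proved): **an `L²(DG)`-eigenvector of the kernel operator with a non-zero eigenvalue has a
continuous, left-`G(k)`-invariant representative** — `ψ' := c⁻¹ K_f ψ` (continuous by `continuous_kernelOp`,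
invariant by `kernelOp_invariant`, equal to `ψ` a.e. by the eigen-equation).  With rungs (1)–(2) and Mathlib's
spectral theorem for compact self-adjoint operators this makes the eigenspaces of `R(f̄ ⋆ f)` spaces of continuous
invariant functions; the `G`-invariant irreducible refinement (rung (4)) is what J1 still needs. -/
theorem exists_continuous_invariant_of_eigen [SecondCountableTopology G] {f : G → ℂ} (hf : IsTest f)
    (ψ : Lp ℂ 2 (S.μ.restrict S.DG)) {c : ℂ} (hc : c ≠ 0)
    (hψ : S.kernelOp f ψ =ᵐ[S.μ.restrict S.DG] fun x => c * ψ x) :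
    ∃ ψ' : G → ℂ, Continuous ψ' ∧ S.Invariant ψ' ∧ ⇑ψ =ᵐ[S.μ.restrict S.DG] ψ' := by
  haveI : IsFiniteMeasure (S.μ.restrict S.DG) := S.isFiniteMeasure_restrict_DG
  refine ⟨fun x => c⁻¹ * S.kernelOp f ψ x,
    continuous_const.mul (S.continuous_kernelOp hf ((Lp.memLp ψ).integrable one_le_two)), ?_, ?_⟩
  · intro γ x
    show c⁻¹ * S.kernelOp f ψ (γ * x) = c⁻¹ * S.kernelOp f ψ x
    rw [S.kernelOp_invariant f ψ γ x]
  · filter_upwards [hψ] with x hx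
    show ψ x = c⁻¹ * S.kernelOp f ψ x
    rw [hx, inv_mul_cancel_left₀ hc]

end Setting

end RTF

end Summit.Ventures.HodgeRepro.Tier4.Line1
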